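import Summits.CriticalPhenomena.PercolationContinuityZ3.Theorems.PercNearOneGluingNoHeavyLowerTailThreePointProductFormFibreAntithetic
import HarnessLib

/-!
# The product form `#bad² ≤ #P1·#P2` in the fibre language: `bad` IS AN EXACT HARRIS-MINUS-BK GAP
# (Sahi programme, prover prim-sahi-p2 gen 54)

Support file (`--supports stmt-CriticalPhenomena-4575`, helper); continues `…ThreePointProductFormFibreAntithetic`.  Standard axioms, no
sorries, no named facts, no definitions.  Memo `run/shared/lean/prim/prim-sahi/FROM-prim-sahi-p2-gen54-CERTIFICATE-SHAPE.md` §0 (3‴), PROOF-E3 (64v).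

With the facecert vocabulary of `…ThreePointCPIClusterSwapDefs` — `CReach ends z t v` (`v` in the CLOSED cluster `Q_t(z)`),
`UReach ends u t z v` (`v` joined to `u` by an OPEN path avoiding `V(Q_t(z))`) — and `♭z = clusterFlip ends a z̄`:
* `ureach_flat_of_sep` / `sep_of_ureach_flat` / `sep_iff_ureach_flat` [this work] — for `s ≠ c`:
  `(a ↮ s, a ↮ c, s ↔ c in z) ⟺ UReach ends s a (♭z) c`: an `s–c` connection avoiding the apex cluster is, after the flat, an open `s–c`
  path avoiding the closed apex cluster (`Q_a(♭z)` is the open apex cluster of `z`; labels off it keep their value).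
* `card_sep_eq_card_ureach` [this work] — `#{a ↮ s, a ↮ c, s ↔ c} = #{z : UReach ends s a z c}` (bijection `z ↦ ♭z`).
* **`card_bad_eq_joint_sub_disjoint`** [this work] — THE GAP FORM: for `s ≠ c`,
  `#bad = #{z : s ↔ c open, a ∉ Q-cluster of s and c (¬CReach a s, ¬CReach a c)} − #{z : UReach ends s a z c}`,
  i.e. with the increasing events `𝒜 = {s ↔ c}` and `ℬ = {Q_a(z) ∌ s, c}` (= 'the open edges contain a cut between `a` and `{s,c}`'):
  `#bad = #(𝒜 ∩ ℬ) − #(𝒜 □ ℬ)`, the disjoint occurrence `𝒜 □ ℬ` being 'an open `s–c` path avoiding `V(Q_a)`' (cf. `box_iff_ureach` of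
  `…ThreePointCPIClusterSwapBox` for the facecert pair).  Harris gives `#(𝒜 ∩ ℬ)·2^m ≥ #𝒜·#ℬ`, BK gives `#(𝒜 □ ℬ)·2^m ≤ #𝒜·#ℬ`; CONJECTURE (P)
  bounds the total gap: `(#(𝒜 ∩ ℬ) − #(𝒜 □ ℬ))² ≤ #{a ↔ s, a ↮ c}·#{a ↔ c, a ↮ s}` (`productForm_iff_gap`).
[folklore] (walk transfer between graphs with the same relevant edges); [cite: Gladkov2024, Conjecture 10.1 (p. 18), arXiv:2408.08457] for (P).
-/

namespace Summit.CriticalPhenomena.PercolationContinuityZ3.Theorems.ProductFormFibre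

open Finset Literature.Probability.Percolation
open Summit.CriticalPhenomena.PercolationContinuityZ3.Theorems.ThreePointCPIClusterSwap
  (CReach QTouch UReach avoidQ clusterFlip clusterFlip_of_qtouch clusterFlip_of_not_qtouch clusterFlip_clusterFlip
    creach_clusterFlip_iff)

variable {V α : Type*}

section Gap

variable (ends : α → Sym2 V) (a : V)

/-- The closed apex cluster of `♭z` is the open apex cluster of `z`. [this work] -/
theorem creach_flat_iff (z : α → Bool) (v : V) :
    CReach ends (clusterFlip ends a fun l => !z l) a v ↔ (openGraph (labelledOpen ends z)).Reachable a v :=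
  reachable_compl_flat_iff ends a z v

/-- An open walk of `z` from a vertex outside the apex cluster is an open walk of `♭z` avoiding `V(Q_a(♭z))`. [this work] -/
theorem ureach_flat_of_walk (z : α → Bool) :
    ∀ {u w : V} (_ : (openGraph (labelledOpen ends z)).Walk u w),
      ¬ (openGraph (labelledOpen ends z)).Reachable a u →
      UReach ends u a (clusterFlip ends a fun l => !z l) w
  | _, _, .nil, _ => SimpleGraph.Reachable.refl _
  | u, w, .cons (v := x) hadj p, hu => by
      have hx : ¬ (openGraph (labelledOpen ends z)).Reachable a x :=
        fun hx => hu (hx.trans hadj.reachable.symm)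
      have hadj' : (openGraph (avoidQ ends a (clusterFlip ends a fun l => !z l))).Adj u x := by
        rw [openGraph_adj] at hadj ⊢
        obtain ⟨⟨l, hl, hle⟩, hux⟩ := hadj
        have hends : ∀ y ∈ ends l, ¬ (openGraph (labelledOpen ends z)).Reachable a y := by
          intro y hy
          rw [hle, Sym2.mem_iff] at hy
          rcases hy with rfl | rfl
          · exact hu
          · exact hx
        refine ⟨⟨⟨l, ?_, hle⟩, ?_⟩, hux⟩
        · rw [flat_apply_of_not_reachable ends a z hends]; exact hl
        · intro y hy
          rw [creach_flat_iff]
          rw [← hle] at hy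
          exact hends y hy
      exact hadj'.reachable.trans (ureach_flat_of_walk z p hx)

/-- `P3 ⟹ UReach` after the flat. [this work] -/
theorem ureach_flat_of_sep (z : α → Bool) {s c : V}
    (has : ¬ (openGraph (labelledOpen ends z)).Reachable a s) (hsc : (openGraph (labelledOpen ends z)).Reachable s c) :
    UReach ends s a (clusterFlip ends a fun l => !z l) c := by
  obtain ⟨p⟩ := hsc
  exact ureach_flat_of_walk ends a z p has

/-- An open walk of `♭z` avoiding `V(Q_a(♭z))` is an open walk of `z`, and its endpoints are outside the apex cluster of `z`. [this work] -/
theorem sep_of_ureach_walk (z : α → Bool) :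
    ∀ {u w : V} (_ : (openGraph (avoidQ ends a (clusterFlip ends a fun l => !z l))).Walk u w),
      (openGraph (labelledOpen ends z)).Reachable u w ∧
        (u ≠ w → ¬ (openGraph (labelledOpen ends z)).Reachable a u ∧ ¬ (openGraph (labelledOpen ends z)).Reachable a w)
  | _, _, .nil => ⟨SimpleGraph.Reachable.refl _, fun h => absurd rfl h⟩
  | u, w, .cons (v := x) hadj p => by
      rw [openGraph_adj] at hadj
      obtain ⟨⟨⟨l, hl, hle⟩, hav⟩, hux⟩ := hadj
      have hu : ¬ (openGraph (labelledOpen ends z)).Reachable a u := by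
        rw [← creach_flat_iff ends a z u]; exact hav u (Sym2.mem_mk_left u x)
      have hx : ¬ (openGraph (labelledOpen ends z)).Reachable a x := by
        rw [← creach_flat_iff ends a z x]; exact hav x (Sym2.mem_mk_right u x)
      have hzl : z l = true := by
        rw [← flat_apply_of_not_reachable ends a z (l := l) ?_]
        · exact hl
        · intro y hy
          rw [hle, Sym2.mem_iff] at hy
          rcases hy with rfl | rfl
          · exact hu
          · exact hx
      have hadjz : (openGraph (labelledOpen ends z)).Adj u x := by
        rw [openGraph_adj]; exact ⟨⟨l, hzl, hle⟩, hux⟩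
      obtain ⟨hxw, hend⟩ := sep_of_ureach_walk z p
      refine ⟨hadjz.reachable.trans hxw, fun _ => ⟨hu, ?_⟩⟩
      by_cases hxw' : x = w
      · subst hxw'; exact hx
      · exact (hend hxw').2

/-- `UReach` after the flat `⟹ P3` (for `s ≠ c`). [this work] -/
theorem sep_of_ureach_flat (z : α → Bool) {s c : V} (hsc : s ≠ c)
    (h : UReach ends s a (clusterFlip ends a fun l => !z l) c) :
    ¬ (openGraph (labelledOpen ends z)).Reachable a s ∧ ¬ (openGraph (labelledOpen ends z)).Reachable a c ∧
      (openGraph (labelledOpen ends z)).Reachable s c := by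
  obtain ⟨p⟩ := h
  obtain ⟨hr, hend⟩ := sep_of_ureach_walk ends a z p
  exact ⟨(hend hsc).1, (hend hsc).2, hr⟩

/-- **`P3` is 'open `s–c` path avoiding the closed apex cluster' after the flat.** [this work] -/
theorem sep_iff_ureach_flat (z : α → Bool) {s c : V} (hsc : s ≠ c) :
    (¬ (openGraph (labelledOpen ends z)).Reachable a s ∧ ¬ (openGraph (labelledOpen ends z)).Reachable a c ∧
      (openGraph (labelledOpen ends z)).Reachable s c) ↔
    UReach ends s a (clusterFlip ends a fun l => !z l) c :=
  ⟨fun h => ureach_flat_of_sep ends a z h.1 h.2.2, sep_of_ureach_flat ends a z hsc⟩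

/-- The disjoint occurrence is part of the joint occurrence: `UReach s a z c ⟹ s ↔ c open and Q_a(z) ∌ s, c` (`s ≠ c`). [this work] -/
theorem joint_of_ureach (z : α → Bool) {s c : V} (hsc : s ≠ c) (h : UReach ends s a z c) :
    (openGraph (labelledOpen ends z)).Reachable s c ∧ (¬ CReach ends z a s ∧ ¬ CReach ends z a c) := by
  obtain ⟨p⟩ := h
  -- transfer the walk to the open graph and read off the endpoints
  have key : ∀ {u w : V} (_ : (openGraph (avoidQ ends a z)).Walk u w),
      (openGraph (labelledOpen ends z)).Reachable u w ∧ (u ≠ w → ¬ CReach ends z a u ∧ ¬ CReach ends z a w) := by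
    intro u w q
    induction q with
    | nil => exact ⟨SimpleGraph.Reachable.refl _, fun h => absurd rfl h⟩
    | @cons u x w hadj q ih =>
        rw [openGraph_adj] at hadj
        obtain ⟨⟨hopen, hav⟩, hux⟩ := hadj
        have hadjz : (openGraph (labelledOpen ends z)).Adj u x := by rw [openGraph_adj]; exact ⟨hopen, hux⟩
        refine ⟨hadjz.reachable.trans ih.1, fun _ => ⟨hav u (Sym2.mem_mk_left u x), ?_⟩⟩
        by_cases hxw : x = w
        · subst hxw; exact hav x (Sym2.mem_mk_right u x)
        · exact (ih.2 hxw).2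
  obtain ⟨hr, hend⟩ := key p
  exact ⟨hr, hend hsc⟩

variable [Fintype α] [DecidableEq α]

open Classical in
/-- **`#P3 = #{UReach s a · c}`** (bijection `z ↦ ♭z`, inverse `w ↦ (μ_a w)̄`). [this work] -/
theorem card_sep_eq_card_ureach (s c : V) (hsc : s ≠ c) :
    (univ.filter fun z : α → Bool =>
        ¬ (openGraph (labelledOpen ends z)).Reachable a s ∧ ¬ (openGraph (labelledOpen ends z)).Reachable a c ∧
          (openGraph (labelledOpen ends z)).Reachable s c).card =
    (univ.filter fun w : α → Bool => UReach ends s a w c).card := by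
  refine Finset.card_bij' (fun z _ => clusterFlip ends a fun l => !z l)
    (fun w _ => fun l => !(clusterFlip ends a w) l) ?_ ?_ ?_ ?_
  · intro z hz
    rw [Finset.mem_filter] at hz ⊢
    exact ⟨Finset.mem_univ _, (sep_iff_ureach_flat ends a z hsc).1 hz.2⟩
  · intro w hw
    rw [Finset.mem_filter] at hw ⊢
    refine ⟨Finset.mem_univ _, (sep_iff_ureach_flat ends a _ hsc).2 ?_⟩
    rw [flat_compl_clusterFlip ends a w]
    exact hw.2
  · intro z _
    show (fun l => !(clusterFlip ends a (clusterFlip ends a fun l' => !z l')) l) = z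
    rw [clusterFlip_clusterFlip]
    exact compl_compl_conf z
  · intro w _
    exact flat_compl_clusterFlip ends a w

open Classical in
/-- **`bad` IS AN EXACT HARRIS-MINUS-BK GAP.**  For `s ≠ c`:
`#bad = #{z : s ↔ c open, ¬CReach a s, ¬CReach a c} − #{z : UReach ends s a z c}` — joint occurrence of the increasing events
`𝒜 = {s ↔ c}` and `ℬ = {Q_a ∌ s, c}` minus their disjoint occurrence 'open `s–c` path avoiding `V(Q_a)`'. [this work] -/
theorem card_bad_eq_joint_sub_disjoint (s c : V) (hsc : s ≠ c) :
    (univ.filter fun z : α → Bool =>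
        (¬ (openGraph (labelledOpen ends z)).Reachable a s ∧ ¬ (openGraph (labelledOpen ends z)).Reachable a c ∧
          ¬ (openGraph (labelledOpen ends z)).Reachable s c) ∧
        (openGraph (labelledOpen ends (clusterFlip ends a fun l => !z l))).Reachable s c).card =
    (univ.filter fun z : α → Bool =>
        (openGraph (labelledOpen ends z)).Reachable s c ∧ (¬ CReach ends z a s ∧ ¬ CReach ends z a c)).card -
    (univ.filter fun z : α → Bool => UReach ends s a z c).card := by
  rw [← card_sep_eq_card_ureach ends a s c hsc]
  exact card_bad_eq_antithetic_sub ends a s c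

open Classical in
/-- **CONJECTURE (P) as a bound on the Harris-minus-BK gap** (`s ≠ c`):
`(P) ⟺ (#{s ↔ c, Q_a ∌ s,c} − #{UReach s a · c})² ≤ #{a ↔ s, a ↮ c} · #{a ↔ c, a ↮ s}`. [this work] -/
theorem productForm_iff_gap (s c : V) (hsc : s ≠ c) :
    (univ.filter fun z : α → Bool =>
        (¬ (openGraph (labelledOpen ends z)).Reachable a s ∧ ¬ (openGraph (labelledOpen ends z)).Reachable a c ∧
          ¬ (openGraph (labelledOpen ends z)).Reachable s c) ∧
        (openGraph (labelledOpen ends (clusterFlip ends a fun l => !z l))).Reachable s c).card ^ 2 ≤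
    (univ.filter fun z : α → Bool =>
        (openGraph (labelledOpen ends z)).Reachable a s ∧ ¬ (openGraph (labelledOpen ends z)).Reachable a c).card *
    (univ.filter fun z : α → Bool =>
        (openGraph (labelledOpen ends z)).Reachable a c ∧ ¬ (openGraph (labelledOpen ends z)).Reachable a s).card ↔
    ((univ.filter fun z : α → Bool =>
        (openGraph (labelledOpen ends z)).Reachable s c ∧ (¬ CReach ends z a s ∧ ¬ CReach ends z a c)).card -
     (univ.filter fun z : α → Bool => UReach ends s a z c).card) ^ 2 ≤
    (univ.filter fun z : α → Bool =>
        (openGraph (labelledOpen ends z)).Reachable a s ∧ ¬ (openGraph (labelledOpen ends z)).Reachable a c).card *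
    (univ.filter fun z : α → Bool =>
        (openGraph (labelledOpen ends z)).Reachable a c ∧ ¬ (openGraph (labelledOpen ends z)).Reachable a s).card := by
  rw [card_bad_eq_joint_sub_disjoint ends a s c hsc]

end Gap

end Summit.CriticalPhenomena.PercolationContinuityZ3.Theorems.ProductFormFibre
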